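import Literature.MathematicalPhysics.QuantumFieldTheory.Balaban1983to89.Node00.OpsYCubeDirInverseBond
import Literature.MathematicalPhysics.QuantumFieldTheory.Balaban1983to89.Node00.OpsYCubeProjectionG
import Literature.MathematicalPhysics.QuantumFieldTheory.Balaban1983to89.Node00.OpsYRecordV10

/-!
# `Balaban1983to89.B9Eq3105DirichletBondLettersAtOneY` — T. Bałaban, *Propagators for lattice gauge theories in a background field*, Commun. Math. Phys. **99** (1985)
# 389–434 [Balaban1985BackgroundPropagators], p. 395 («It coincides with Δ_a in (2.19) if U = 1»), (3.25)–(3.27) pp. 394–395, p. 409 l. 3–5 («the operators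
# constructed for this sequence … G′_□(U), C_□(U), G_□(U)»), Cor. 3.5 p. 407 («for U = 1 … proved in [4]»); [4] = [Balaban1984PropagatorsII] (2.19) p. 227,
# (2.69) p. 235: THE `U = 1` MATRIX READING OF THE DIRICHLET BOND OPERATOR `Δ_loc[𝔮](1) − D P_□(1) D*` OF THE CUBE SEQUENCE `{Ω_n(□)}` — the `hT1` socket of
# node00-def-Y's `OpsYCubeDirInverseBond.GDirBY_one_eq_liftOpY` at the (γ) letters of the N06 heads of record

statement-level skeleton of published theorems with citation tags; proofs where landed; nothing here is a claim about the Yang–Mills mass gap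

THE PRINT.  p. 395: «Δ_a = Δ + DRD* + Q*aQ. It coincides with Δ_a in (2.19) if U = 1.»; (3.25) p. 394 `R = I − G′Q′*(Q′G′²Q′*)⁻¹Q′G′`; p. 409 l. 3–5 «The operators
constructed for this sequence, which we denote by G′_□(U), C_□(U) = (Q(U)G′_□²(U)Q*(U))⁻¹, G_□(U), satisfy all the inequalities of Theorems 3.1–3.3 correspondingly»;
Cor. 3.5 p. 407 «for U = 1 … proved in [4]».  At `U = 1` every transporter is `1`, the covariant letters are the flat lattice letters `∂, ∂*, Q = q♯, Q* = q*♯,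
a = a♯`, the curvature insertion vanishes (`Δ(1) = ∂*∂`), and the sequence's `G′_□(1)`, `(Q′G′_□²Q′*)⁻¹(1)` are Dirichlet inverses of FLAT matrices on the sites
∕ blocks of `Ω₀(□)`.

WHY THIS FILE (cell `pub-ymgap`, node N06; dag-lead g46 WORDS 816 (1) assignment «n06-j TAKE (u1)»; director-ym №606 road (B5)).  The N06 heads of record
«KESC-AγJ» ∕ «KE₁₆X-Aγ» (dag-n06-d g33) pin the bond cube letter `G_□(U) := GDirBY x 𝔮 𝔮⋆ (DPDsDirCubeY x □ (dirDomY x □)) (bondsOverY x (dirDomY x □))` with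
`(𝔮, 𝔮⋆) = (qKnitOfRecord, qsKnitOfRecord)` (print's knit averaging of (3.115)).  node00-def-Y's `GDirBY_one_eq_liftOpY` reads `G_□(1)` as the lift of an explicit
real matrix `𝟙_B K 𝟙_B` from TWO displayed inputs: `hT1 : Δ_loc[𝔮](1) − Pl(1) = M♯` (the flat operator as a matrix lift) and `hK` (a real `K` inverting the compression
of `M` to `B`).  THIS FILE supplies `hT1` at the (γ) letters: `Pl := DPDsDirCubeY i □ S`, `(𝔮, 𝔮⋆) :=` the knit pair of record — the groundwork for №606's first
deliverable (the `U = 1` Dirichlet bond kernel bound, dag-n06-c's lane), which supplies `K` and its decay.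

WHAT IS DEFINED AND PROVED (sorry-free; three matrix `def`s with bodies + theorems; no `def … : Prop`, no estimate, no inverse taken by this file).
* §1 (generic pair with flat `U = 1` faces `𝔮(1) = Mq♯`, `𝔮⋆(1) = Mqs♯`; any complete normed `ℂ`-algebra `𝔸`) `deltaLocMatQY i Mq Mqs := cocurlK·curlK + gradK·divK +
  Mqs·aK·Mq` and ★ `deltaLocQY_one_liftMatY` (`Δ_loc[𝔮](1) = (deltaLocMatQY …)♯` — def-Y `hessY_one`, `gradY_one`, `divY_one`, `aY := aK♯`).
* §2 (the Dirichlet projection of the sequence at `U = 1`, generic site set `S`, knit cube legs `parKnitCubeY` — trivial at `U = 1`): `blkProjY_eq_indProjY` (dictionary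
  G ↔ H), `XCubeGY_parKnitCubeY_GpDirY_one` (`(Q′_□G′_□²Q′*_□)(1) = (q′_□ K̃ K̃ q′*_□)♯`, `K̃ := 𝟙_S K 𝟙_S`, from def-Y `GpDirY_one_eq_liftOpY (hK)` and r05
  `QpCubeY_one` ∕ `QpsCubeY_one`), `xDirMatY` (that flat matrix), ★ `XinvCubeDY_parKnitCubeY_GpDirY_one (hK) (hKX)` (`= (𝟙_𝔖 K_X 𝟙_𝔖)♯` by def-Y
  `dirInvY_indProjY_liftOpY`, `𝔖 := insideBlkY i □ S`, `hKX` the second DISPLAYED inverse socket), `pDirMatY` (`K̃ q′*_□ (𝟙_𝔖K_X𝟙_𝔖) q′_□ K̃`), `PCubeDY_…_one`,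
  ★★ `DPDsDirCubeY_one_liftMatY (hK) (hKX)` (`D P_□(1) D* = (gradK · pDirMatY · divK)♯`).
* §3 ★★ `deltaLocQY_sub_DPDsDirCubeY_one (h𝔮) (h𝔮s) (hK) (hKX)` (generic flat pair) and ★★★ `hT1_knitRecord_dirichletBond (hK) (hKX)` — at the knit pair of record
  (`qKnitOfRecord_flat`, `qsKnitOfRecord_one_eq`, `𝔸 = M_N(ℂ)`): `deltaLocQY i (qKnitOfRecord …) (qsKnitOfRecord …) 1 − DPDsDirCubeY i □ S 1 = liftOpY 𝔸 (mlocDirBMatY i □ S K K_X)`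
  with `mlocDirBMatY := deltaLocMatQY i (qK i) (qsK i) − gradK · pDirMatY · divK` — LITERALLY the `hT1` premise of `GDirBY_one_eq_liftOpY` at the (γ) letters; corollary
  ★★★ `GDirBY_knitRecord_one_eq_liftOpY (hK) (hKX) (hKB)` (= def-Y's clause applied: `G_□(1) = (𝟙_B K_B 𝟙_B)♯` for any real `K_B` inverting the compression of
  `mlocDirBMatY` to `B`).
HONEST SCOPE.  Dictionary algebra at `U = 1` over landed letters ([folklore] bookkeeping around p. 395 ∕ (3.25) ∕ p. 409 l. 3–5); the three inverse sockets `hK` (sites of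
`S`: r05's flat cube-sequence operator `mlOpT …`, dag-n06-c D3c), `hKX` (blocks inside `S`) and `hKB` (bonds over `S`) stay DISPLAYED — no matrix is inverted and no kernel is
bounded here (that is №606's first deliverable); nothing of Theorems 3.1–3.3 ∕ 3.10 asserted; no Node00 letter modified (all consumed by name).  COUNT-NEUTRAL
(`--supports stmt-QuantumFields-27364`); N06 NOT discharged; K1⁹ NOT closed.  One finite lattice at a time — nothing continuum ∕ ℝ⁴ ∕ OS ∕ mass gap ∕ Clay; the Yang–Mills
mass gap is NOT proved here.  NEW file; nothing landed is modified.  No `sorry`, no `axiom`, no `instance`, no `notation`.  Net new unproved facts: 0.  Cell `pub-ymgap`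
(HUMAN RULING D-0062), node N06 [B9], seat `pub-ymgap-dag-n06-j` (g39), 2026-08-31.
RELATED, NOT DUPLICATED (searched 2026-08-31: `rg 'DirichletBondLettersAtOne|deltaLocQY_one|DPDsDirCubeY_one|mlocDirBMatY|pDirMatY|xDirMatY'` over `Literature ∕ Summits` = ∅):
r05 `B9CubeLettersBondOpsAtOneL0` (the same reading for the WHOLE-TORUS cube letters `deltaACubeY ∕ GACubeY` at the straight pair), def-Y `OpsYSectDQ.deltaAQY_one_liftY`
(the global `Δ_a[𝔮](1)`), def-Y `OpsYCubeDirInverse.GpDirY_one_eq_liftOpY` ∕ `OpsYCubeDirInverseBond.dirInvY_indProjY_liftOpY` ∕ `GDirBY_one_eq_liftOpY` (consumed by name).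
-/

noncomputable section

namespace Literature.MathematicalPhysics.QuantumFieldTheory.Balaban1983to89.B9Eq3105DirichletBondLettersAtOneY

open Node00
open B6KLevelCensusIndexV1 (KIdx)
open B6Cover236MultiLevelBlocks (cubes)
open B6MultiLevelTorusOperator (mlOpT)
open B9Thm31CubeLocalFlat (wCube)
open B9CubeLettersOpsL0 (cubeFamY)
open B9CubeLettersBondOpsL0 (BlkCubeY QpCubeY QpsCubeY qpKc qpsKc QpCubeY_one QpsCubeY_one)
open B9Cor35AtOneInverseLetters (liftOpY_mul)
open B9Eq3105OfLocalInverseQ (deltaLocQY)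
open Node00.OpsYLocalInverse (dirPadY dirInvY)
open Node00.OpsYCubeDirInverse (GpDirY GpDirY_one_eq_liftOpY indDiagY)
open Node00.OpsYCubeDirInverseBond (indProjY indProjY_apply dirInvY_indProjY_liftOpY GDirBY GDirBY_one_eq_liftOpY)
open Node00.OpsYCubeKnitPar (parKnitCubeY parKnitCubeY_one)
open Node00.OpsYCubeProjectionG (insideBlkY blkProjY blkProjY_apply XCubeGY XinvCubeDY PCubeDY RCubeDY DPDsCubeDY DPDsDirCubeY id_sub_RCubeDY)
open Node00.OpsYQLetter (QLetterY QsLetterY qKnitOfRecord qsKnitOfRecord)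
open scoped Matrix

variable {d ℓ : ℕ} {hd : 1 ≤ d + 1} {hL : Odd (ℓ + 1) ∧ 1 < ℓ + 1} {b₀ b₁ : ℝ}
variable {𝔸 : Type} [NormedRing 𝔸] [NormedAlgebra ℂ 𝔸] [CompleteSpace 𝔸]
variable (i : KIdx d ℓ hd hL b₀ b₁)

/-! ## §1 `Δ_loc[𝔮](1)` as a matrix lift, for any pair with flat `U = 1` faces -/

section DeltaLoc

/-- **THE FLAT MATRIX OF `Δ_loc[𝔮](1)`**: `∂ᶜ*∂ᶜ + ∂∂* + Mqs·a·Mq` on the fine bonds, for an averaging pair whose `U = 1` faces are the lifts of `Mq`, `Mqs`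
(print's «It coincides with Δ_a in (2.19) if U = 1», the `DD*` part in place of `DRD*`). [cite: Balaban1985BackgroundPropagators, p.395, (3.26) p.395; Balaban1984PropagatorsII, (2.19) p.227] -/
def deltaLocMatQY (Mq : Matrix (IBondY i) (FBondY i) ℝ) (Mqs : Matrix (FBondY i) (IBondY i) ℝ) : Matrix (FBondY i) (FBondY i) ℝ :=
  cocurlK i * curlK i + gradK i * divK i + Mqs * aK i * Mq

/-- ★ **`Δ_loc[𝔮](1) = (deltaLocMatQY i Mq Mqs)♯`** for any pair with `𝔮(1) = Mq♯`, `𝔮⋆(1) = Mqs♯` (def-Y's `hessY_one`, `gradY_one`, `divY_one`, `aY = aK♯`).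
[cite: Balaban1985BackgroundPropagators, p.395, (3.10) p.392 (Δ(1) = ∂*∂); Balaban1984PropagatorsII, (2.19) p.227] -/
theorem deltaLocQY_one_liftMatY (𝔮 : QLetterY 𝔸 i) (𝔮s : QsLetterY 𝔸 i) {Mq : Matrix (IBondY i) (FBondY i) ℝ} {Mqs : Matrix (FBondY i) (IBondY i) ℝ}
    (h𝔮 : 𝔮 (fun _ _ => 1) = liftMatY 𝔸 Mq) (h𝔮s : 𝔮s (fun _ _ => 1) = liftMatY 𝔸 Mqs) :
    deltaLocQY i 𝔮 𝔮s (fun _ _ => 1) = liftMatY 𝔸 (deltaLocMatQY i Mq Mqs) := by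
  rw [deltaLocQY, hessY_one, gradY_one, divY_one, h𝔮, h𝔮s, aY, deltaLocMatQY]
  simp only [← liftMatY_mul, ← liftMatY_add, Matrix.mul_assoc]

end DeltaLoc

/-! ## §2 The Dirichlet projection `D P_□(1) D*` of the cube sequence at `U = 1` -/

section Projection

variable (q : ↥(cubes (toKT i).D.toDomains))

omit [CompleteSpace 𝔸] in
/-- dictionary: node00-def-Y's block projection `blkProjY 𝔖` (file G) IS the indicator projection `indProjY 𝔖` (file H) on the cube sequence's blocks.
[cite: Balaban1985BackgroundPropagators, p.394, p.409 l.1–5, dictionary] -/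
theorem blkProjY_eq_indProjY (𝔖 : Finset (BlkCubeY i q)) : blkProjY (𝔸 := 𝔸) i q 𝔖 = indProjY 𝔖 := by
  refine LinearMap.ext fun ω => funext fun s => ?_
  rw [blkProjY_apply, indProjY_apply]

/-- **THE FLAT MATRIX OF `(Q′_□G′_□²Q′*_□)(1)`**: `q′_□ · K̃ · K̃ · q′*_□` with `K̃ := 𝟙_S K 𝟙_S` the matrix of `G′_□(1)`.
[cite: Balaban1985BackgroundPropagators, (3.25) p.394, p.409 l.3–5, Cor. 3.5 p.407] -/
def xDirMatY (S : Finset (SiteY i)) (K : Matrix (SiteY i) (SiteY i) ℝ) : Matrix (BlkCubeY i q) (BlkCubeY i q) ℝ :=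
  qpKc i q * (indDiagY S * K * indDiagY S) * (indDiagY S * K * indDiagY S) * qpsKc i q

/-- **THE FLAT MATRIX OF `P_□(1)`**: `K̃ · q′*_□ · (𝟙_𝔖 K_X 𝟙_𝔖) · q′_□ · K̃`, `𝔖 := insideBlkY i □ S`.
[cite: Balaban1985BackgroundPropagators, (3.25) p.394, p.409 l.3–5] -/
def pDirMatY (S : Finset (SiteY i)) (K : Matrix (SiteY i) (SiteY i) ℝ) (KX : Matrix (BlkCubeY i q) (BlkCubeY i q) ℝ) : Matrix (SiteY i) (SiteY i) ℝ :=
  (indDiagY S * K * indDiagY S) * qpsKc i q * (indDiagY (insideBlkY i q S) * KX * indDiagY (insideBlkY i q S)) * qpKc i q *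
    (indDiagY S * K * indDiagY S)

variable {q}

/-- `G′_□(1) = K̃♯` at the knit cube legs (def-Y's `GpDirY_one_eq_liftOpY`; the legs are `1` at `U = 1`, `parKnitCubeY_one`).
[cite: Balaban1985BackgroundPropagators, p.394, Cor. 3.5 p.407, p.409 l.3–5] -/
theorem GpDirY_parKnitCubeY_one (S : Finset (SiteY i)) {K : Matrix (SiteY i) (SiteY i) ℝ}
    (hK : (mlOpT (toKT i).NB ℓ (toKT i).k (cubeFamY i q).lev (wCube ℓ)).submatrix (fun v : ↥S => (v : SiteY i)) (fun v : ↥S => (v : SiteY i)) *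
      K.submatrix (fun v : ↥S => (v : SiteY i)) (fun v : ↥S => (v : SiteY i)) = 1) :
    GpDirY i q (parKnitCubeY i q) S (fun _ _ => (1 : 𝔸ˣ)) = liftMatY 𝔸 (indDiagY S * K * indDiagY S) :=
  GpDirY_one_eq_liftOpY i q (parKnitCubeY i q) (parKnitCubeY_one i q) S hK

/-- ★ `(Q′_□G′_□²Q′*_□)(1) = (xDirMatY …)♯`. [cite: Balaban1985BackgroundPropagators, (3.25) p.394, Cor. 3.5 p.407, p.409 l.3–5] -/
theorem XCubeGY_parKnitCubeY_GpDirY_one (S : Finset (SiteY i)) {K : Matrix (SiteY i) (SiteY i) ℝ}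
    (hK : (mlOpT (toKT i).NB ℓ (toKT i).k (cubeFamY i q).lev (wCube ℓ)).submatrix (fun v : ↥S => (v : SiteY i)) (fun v : ↥S => (v : SiteY i)) *
      K.submatrix (fun v : ↥S => (v : SiteY i)) (fun v : ↥S => (v : SiteY i)) = 1) :
    XCubeGY i q (parKnitCubeY i q) (GpDirY i q (parKnitCubeY i q) S) (fun _ _ => (1 : 𝔸ˣ)) = liftMatY 𝔸 (xDirMatY i q S K) := by
  rw [XCubeGY, QpCubeY_one i q (parKnitCubeY_one i q), QpsCubeY_one i q (parKnitCubeY_one i q), GpDirY_parKnitCubeY_one i S hK, xDirMatY]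
  simp only [← liftMatY_mul, Matrix.mul_assoc]

/-- ★ **`(Q′_□G′_□²Q′*_□)⁻¹(1)` ON THE BLOCKS INSIDE `S`** `= (𝟙_𝔖 K_X 𝟙_𝔖)♯` for ANY real `K_X` inverting the compression of `xDirMatY` to `𝔖 = insideBlkY i □ S`
(def-Y's lift clause `dirInvY_indProjY_liftOpY`). [cite: Balaban1985BackgroundPropagators, (3.25) p.394 («positive operators»), p.409 l.3–5] -/
theorem XinvCubeDY_parKnitCubeY_GpDirY_one (S : Finset (SiteY i)) {K : Matrix (SiteY i) (SiteY i) ℝ}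
    (hK : (mlOpT (toKT i).NB ℓ (toKT i).k (cubeFamY i q).lev (wCube ℓ)).submatrix (fun v : ↥S => (v : SiteY i)) (fun v : ↥S => (v : SiteY i)) *
      K.submatrix (fun v : ↥S => (v : SiteY i)) (fun v : ↥S => (v : SiteY i)) = 1)
    {KX : Matrix (BlkCubeY i q) (BlkCubeY i q) ℝ}
    (hKX : (xDirMatY i q S K).submatrix (fun v : ↥(insideBlkY i q S) => (v : BlkCubeY i q)) (fun v : ↥(insideBlkY i q S) => (v : BlkCubeY i q)) *
      KX.submatrix (fun v : ↥(insideBlkY i q S) => (v : BlkCubeY i q)) (fun v : ↥(insideBlkY i q S) => (v : BlkCubeY i q)) = 1) :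
    XinvCubeDY i q (parKnitCubeY i q) (GpDirY i q (parKnitCubeY i q) S) (insideBlkY i q S) (fun _ _ => (1 : 𝔸ˣ))
      = liftMatY 𝔸 (indDiagY (insideBlkY i q S) * KX * indDiagY (insideBlkY i q S)) := by
  rw [XinvCubeDY, blkProjY_eq_indProjY, XCubeGY_parKnitCubeY_GpDirY_one i S hK, ← liftOpY_eq_liftMatY, dirInvY_indProjY_liftOpY _ hKX,
    liftOpY_eq_liftMatY]

/-- `P_□(1) = (pDirMatY …)♯`. [cite: Balaban1985BackgroundPropagators, (3.25) p.394, p.409 l.3–5] -/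
theorem PCubeDY_parKnitCubeY_GpDirY_one (S : Finset (SiteY i)) {K : Matrix (SiteY i) (SiteY i) ℝ}
    (hK : (mlOpT (toKT i).NB ℓ (toKT i).k (cubeFamY i q).lev (wCube ℓ)).submatrix (fun v : ↥S => (v : SiteY i)) (fun v : ↥S => (v : SiteY i)) *
      K.submatrix (fun v : ↥S => (v : SiteY i)) (fun v : ↥S => (v : SiteY i)) = 1)
    {KX : Matrix (BlkCubeY i q) (BlkCubeY i q) ℝ}
    (hKX : (xDirMatY i q S K).submatrix (fun v : ↥(insideBlkY i q S) => (v : BlkCubeY i q)) (fun v : ↥(insideBlkY i q S) => (v : BlkCubeY i q)) *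
      KX.submatrix (fun v : ↥(insideBlkY i q S) => (v : BlkCubeY i q)) (fun v : ↥(insideBlkY i q S) => (v : BlkCubeY i q)) = 1) :
    PCubeDY i q (parKnitCubeY i q) (GpDirY i q (parKnitCubeY i q) S) (insideBlkY i q S) (fun _ _ => (1 : 𝔸ˣ)) = liftMatY 𝔸 (pDirMatY i q S K KX) := by
  rw [PCubeDY, XinvCubeDY_parKnitCubeY_GpDirY_one i S hK hKX, QpCubeY_one i q (parKnitCubeY_one i q), QpsCubeY_one i q (parKnitCubeY_one i q),
    GpDirY_parKnitCubeY_one i S hK, pDirMatY]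
  simp only [← liftMatY_mul, Matrix.mul_assoc]

/-- ★★ **`D P_□(1) D* = (∂ · pDirMatY · ∂*)♯`** — the `U = 1` face of the (γ) projection letter `DPDsDirCubeY i □ S`.
[cite: Balaban1985BackgroundPropagators, (3.26) p.395, (3.25) p.394, p.409 l.3–5, (3.105) p.414] -/
theorem DPDsDirCubeY_one_liftMatY (S : Finset (SiteY i)) {K : Matrix (SiteY i) (SiteY i) ℝ}
    (hK : (mlOpT (toKT i).NB ℓ (toKT i).k (cubeFamY i q).lev (wCube ℓ)).submatrix (fun v : ↥S => (v : SiteY i)) (fun v : ↥S => (v : SiteY i)) *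
      K.submatrix (fun v : ↥S => (v : SiteY i)) (fun v : ↥S => (v : SiteY i)) = 1)
    {KX : Matrix (BlkCubeY i q) (BlkCubeY i q) ℝ}
    (hKX : (xDirMatY i q S K).submatrix (fun v : ↥(insideBlkY i q S) => (v : BlkCubeY i q)) (fun v : ↥(insideBlkY i q S) => (v : BlkCubeY i q)) *
      KX.submatrix (fun v : ↥(insideBlkY i q S) => (v : BlkCubeY i q)) (fun v : ↥(insideBlkY i q S) => (v : BlkCubeY i q)) = 1) :
    DPDsDirCubeY i q S (fun _ _ => (1 : 𝔸ˣ)) = liftMatY 𝔸 (gradK i * pDirMatY i q S K KX * divK i) := by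
  rw [DPDsDirCubeY, DPDsCubeDY, id_sub_RCubeDY, PCubeDY_parKnitCubeY_GpDirY_one i S hK hKX, gradY_one, divY_one]
  simp only [← liftMatY_mul, Matrix.mul_assoc]

end Projection

/-! ## §3 The `hT1` socket: `Δ_loc[𝔮](1) − D P_□(1) D*` as one matrix lift, generic flat pair and the knit pair of record -/

section HT1

variable (q : ↥(cubes (toKT i).D.toDomains))

/-- **THE FLAT MATRIX OF THE DIRICHLET BOND OPERATOR `Δ_loc[𝔮](1) − D P_□(1) D*`** for a pair with flat faces `Mq`, `Mqs`: `deltaLocMatQY − ∂·pDirMatY·∂*`.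
[cite: Balaban1985BackgroundPropagators, p.395, (3.26) p.395, p.409 l.3–5; Balaban1984PropagatorsII, (2.19) p.227] -/
def mlocDirBMatQY (Mq : Matrix (IBondY i) (FBondY i) ℝ) (Mqs : Matrix (FBondY i) (IBondY i) ℝ) (S : Finset (SiteY i))
    (K : Matrix (SiteY i) (SiteY i) ℝ) (KX : Matrix (BlkCubeY i q) (BlkCubeY i q) ℝ) : Matrix (FBondY i) (FBondY i) ℝ :=
  deltaLocMatQY i Mq Mqs - gradK i * pDirMatY i q S K KX * divK i

variable {q}

/-- ★★ **THE `hT1` SOCKET, GENERIC FLAT PAIR**: `Δ_loc[𝔮](1) − DPDsDirCubeY i □ S 1 = (mlocDirBMatQY …)♯` as `liftOpY` (the shape of `GDirBY_one_eq_liftOpY`'s premise).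
[cite: Balaban1985BackgroundPropagators, p.395, (3.25)–(3.26) pp.394–395, p.409 l.3–5] -/
theorem deltaLocQY_sub_DPDsDirCubeY_one (𝔮 : QLetterY 𝔸 i) (𝔮s : QsLetterY 𝔸 i) {Mq : Matrix (IBondY i) (FBondY i) ℝ} {Mqs : Matrix (FBondY i) (IBondY i) ℝ}
    (h𝔮 : 𝔮 (fun _ _ => 1) = liftMatY 𝔸 Mq) (h𝔮s : 𝔮s (fun _ _ => 1) = liftMatY 𝔸 Mqs) (S : Finset (SiteY i)) {K : Matrix (SiteY i) (SiteY i) ℝ}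
    (hK : (mlOpT (toKT i).NB ℓ (toKT i).k (cubeFamY i q).lev (wCube ℓ)).submatrix (fun v : ↥S => (v : SiteY i)) (fun v : ↥S => (v : SiteY i)) *
      K.submatrix (fun v : ↥S => (v : SiteY i)) (fun v : ↥S => (v : SiteY i)) = 1)
    {KX : Matrix (BlkCubeY i q) (BlkCubeY i q) ℝ}
    (hKX : (xDirMatY i q S K).submatrix (fun v : ↥(insideBlkY i q S) => (v : BlkCubeY i q)) (fun v : ↥(insideBlkY i q S) => (v : BlkCubeY i q)) *
      KX.submatrix (fun v : ↥(insideBlkY i q S) => (v : BlkCubeY i q)) (fun v : ↥(insideBlkY i q S) => (v : BlkCubeY i q)) = 1) :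
    deltaLocQY i 𝔮 𝔮s (fun _ _ => 1) - DPDsDirCubeY i q S (fun _ _ => 1) = liftOpY 𝔸 (mlocDirBMatQY i q Mq Mqs S K KX) := by
  rw [deltaLocQY_one_liftMatY i 𝔮 𝔮s h𝔮 h𝔮s, DPDsDirCubeY_one_liftMatY i S hK hKX, mlocDirBMatQY, liftOpY_eq_liftMatY, liftMatY_sub]

end HT1

/-! ## §4 At the knit pair of record `(qKnitOfRecord, qsKnitOfRecord)` over `M_N(ℂ)`: the (γ) letters' `hT1`, and `G_□(1)` as a matrix lift -/

section Record

open scoped Matrix.Norms.L2Operator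

variable {N : ℕ} [Nonempty (Fin N)] {θ : Stage3Params} (i : KIdx θ.d₆ θ.ℓ₆ θ.hd' θ.hL' θ.b₀ θ.b₁) (q : ↥(cubes (toKT i).D.toDomains))

/-- **THE FLAT MATRIX OF RECORD** `M_□ := deltaLocMatQY (q) (q*) − ∂·pDirMatY·∂*` (the knit pair is the flat pair `q♯, q*♯` at `U = 1`).
[cite: Balaban1985BackgroundPropagators, p.395, (3.115) p.418, p.409 l.3–5; Balaban1985Averaging, (15) p.19] -/
def mlocDirBMatY (S : Finset (SiteY i)) (K : Matrix (SiteY i) (SiteY i) ℝ) (KX : Matrix (BlkCubeY i q) (BlkCubeY i q) ℝ) :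
    Matrix (FBondY i) (FBondY i) ℝ :=
  mlocDirBMatQY i q (qK i) (qsK i) S K KX

variable {q}

/-- ★★★ **THE `hT1` SOCKET OF THE (γ) BOND LETTER OF RECORD**: at `U = 1`,
`Δ_loc[q_knit](1) − DPDsDirCubeY i □ S 1 = liftOpY M_N(ℂ) (mlocDirBMatY i □ S K K_X)` — the premise `hT1` of def-Y's `GDirBY_one_eq_liftOpY` at
`(𝔮, 𝔮⋆, Pl) = (qKnitOfRecord, qsKnitOfRecord, DPDsDirCubeY i □ S)`, under the two displayed inverse sockets `hK` (sites of `S`) and `hKX` (blocks inside `S`).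
[cite: Balaban1985BackgroundPropagators, p.395 («coincides with Δ_a in (2.19) if U = 1»), (3.25)–(3.26) pp.394–395, p.409 l.3–5, Cor. 3.5 p.407; Balaban1984PropagatorsII, (2.19) p.227] -/
theorem hT1_knitRecord_dirichletBond (S : Finset (SiteY i)) {K : Matrix (SiteY i) (SiteY i) ℝ}
    (hK : (mlOpT (toKT i).NB θ.ℓ₆ (toKT i).k (cubeFamY i q).lev (wCube θ.ℓ₆)).submatrix (fun v : ↥S => (v : SiteY i)) (fun v : ↥S => (v : SiteY i)) *
      K.submatrix (fun v : ↥S => (v : SiteY i)) (fun v : ↥S => (v : SiteY i)) = 1)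
    {KX : Matrix (BlkCubeY i q) (BlkCubeY i q) ℝ}
    (hKX : (xDirMatY i q S K).submatrix (fun v : ↥(insideBlkY i q S) => (v : BlkCubeY i q)) (fun v : ↥(insideBlkY i q S) => (v : BlkCubeY i q)) *
      KX.submatrix (fun v : ↥(insideBlkY i q S) => (v : BlkCubeY i q)) (fun v : ↥(insideBlkY i q S) => (v : BlkCubeY i q)) = 1) :
    deltaLocQY i (qKnitOfRecord N θ i) (qsKnitOfRecord N θ i) (fun _ _ => 1) - DPDsDirCubeY i q S (fun _ _ => 1)
      = liftOpY (Matrix (Fin N) (Fin N) ℂ) (mlocDirBMatY i q S K KX) :=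
  deltaLocQY_sub_DPDsDirCubeY_one i (qKnitOfRecord N θ i) (qsKnitOfRecord N θ i) (qKnitOfRecord_flat N θ i) (qsKnitOfRecord_one_eq i) S hK hKX

/-- ★★★ **`G_□(1)` OF THE (γ) HEADS AS A MATRIX LIFT**: for ANY bond set `B` and ANY real `K_B` inverting the compression of `mlocDirBMatY i □ S K K_X` to `B`,
`GDirBY i q_knit q*_knit (DPDsDirCubeY i □ S) B 1 = (𝟙_B K_B 𝟙_B)♯` — def-Y's `GDirBY_one_eq_liftOpY` with its `hT1` premise DISCHARGED by this file; the three
inverse sockets `hK`, `hKX`, `hKB` displayed. [cite: Balaban1985BackgroundPropagators, (3.27) p.395, p.409 l.3–5, Cor. 3.5 p.407; Balaban1983RegularityDecay, (2.42) p.584] -/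
theorem GDirBY_knitRecord_one_eq_liftOpY (S : Finset (SiteY i)) {K : Matrix (SiteY i) (SiteY i) ℝ}
    (hK : (mlOpT (toKT i).NB θ.ℓ₆ (toKT i).k (cubeFamY i q).lev (wCube θ.ℓ₆)).submatrix (fun v : ↥S => (v : SiteY i)) (fun v : ↥S => (v : SiteY i)) *
      K.submatrix (fun v : ↥S => (v : SiteY i)) (fun v : ↥S => (v : SiteY i)) = 1)
    {KX : Matrix (BlkCubeY i q) (BlkCubeY i q) ℝ}
    (hKX : (xDirMatY i q S K).submatrix (fun v : ↥(insideBlkY i q S) => (v : BlkCubeY i q)) (fun v : ↥(insideBlkY i q S) => (v : BlkCubeY i q)) *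
      KX.submatrix (fun v : ↥(insideBlkY i q S) => (v : BlkCubeY i q)) (fun v : ↥(insideBlkY i q S) => (v : BlkCubeY i q)) = 1)
    (B : Finset (FBondY i)) {KB : Matrix (FBondY i) (FBondY i) ℝ}
    (hKB : (mlocDirBMatY i q S K KX).submatrix (fun v : ↥B => (v : FBondY i)) (fun v : ↥B => (v : FBondY i)) *
      KB.submatrix (fun v : ↥B => (v : FBondY i)) (fun v : ↥B => (v : FBondY i)) = 1) :
    GDirBY i (qKnitOfRecord N θ i) (qsKnitOfRecord N θ i) (DPDsDirCubeY i q S) B (fun _ _ => 1)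
      = liftOpY (Matrix (Fin N) (Fin N) ℂ) (indDiagY B * KB * indDiagY B) :=
  GDirBY_one_eq_liftOpY i (qKnitOfRecord N θ i) (qsKnitOfRecord N θ i) (DPDsDirCubeY i q S) B (hT1_knitRecord_dirichletBond i S hK hKX) hKB

end Record

/-! ## §5 (v1.1) The cube pair (C): the same reading for r05's `Δ_{loc,□} = Δ + DD* + Q*_□ a_□ Q_□` of the cube SEQUENCE's own averaging

dag-n06-c g33's LOCATED-34 (2026-08-31): print's `G_□(U)` (p. 408 l. −14 ff., p. 409 l. 3–5) is built «for this sequence» `{Ω_n(□)}` with the sequence's OWN level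
structure, i.e. over the cube family's averaging pair `Q_□ ∕ Q*_□` (`B9CubeLettersBondOpsL0.QCubeY ∕ QsCubeY`, index bonds `IBondCubeY i □`), which the member-levelled
`deltaLocQY` (index bonds `IBondY i`) cannot host.  The §2 projection reading is pair-free; this section adds the cube-pair twin of §1∕§3, at ANY bond transporter
`parB` with `parB(1) = 1`, so that a `GDirBY`-type Dirichlet letter keyed on `B9Eq3105AtLetters.deltaLocCubeY i □ parB` (the (C) letter, if∕when node00-def-Y re-keys
file H) has its `U = 1` matrix reading by name.  v1.1 is APPEND-ONLY: §1–§4 above are byte-identical to v1.0 (✓p828608). -/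

section CubePair

variable (q : ↥(cubes (toKT i).D.toDomains))

/-- **THE FLAT MATRIX OF `Δ_{loc,□}(1)` FOR THE CUBE PAIR**: `∂ᶜ*∂ᶜ + ∂∂* + q*_□·a_□·q_□` (r05's cube-sequence averaging kernels `qKc ∕ qsKc ∕ aKc`).
[cite: Balaban1985BackgroundPropagators, p.395, (3.26) p.395, p.409 l.3–5; Balaban1984PropagatorsII, (2.19) p.227] -/
def deltaLocCubeMatY : Matrix (FBondY i) (FBondY i) ℝ :=
  cocurlK i * curlK i + gradK i * divK i + B9CubeLettersBondOpsL0.qsKc i q * B9CubeLettersBondOpsL0.aKc i q * B9CubeLettersBondOpsL0.qKc i q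

variable {q}

/-- ★ **`Δ_{loc,□}(1) = (deltaLocCubeMatY i □)♯`** at any bond transporter trivial at `U = 1` (r05 `QCubeY_one ∕ QsCubeY_one`, `aCubeY = aKc♯`; def-Y `hessY_one ∕ gradY_one ∕ divY_one`).
[cite: Balaban1985BackgroundPropagators, p.395 («coincides with Δ_a in (2.19) if U = 1»), (3.10) p.392, p.409 l.3–5] -/
theorem deltaLocCubeY_one_liftMatY {parB : BondParY 𝔸 i} (hparB : ∀ s s', parB (fun _ _ => 1) s s' = 1) :
    B9Eq3105AtLetters.deltaLocCubeY i q parB (fun _ _ => 1) = liftMatY 𝔸 (deltaLocCubeMatY i q) := by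
  rw [B9Eq3105AtLetters.deltaLocCubeY, hessY_one, gradY_one, divY_one, B9CubeLettersBondOpsL0.QCubeY_one i q hparB,
    B9CubeLettersBondOpsL0.QsCubeY_one i q hparB, B9CubeLettersBondOpsL0.aCubeY, deltaLocCubeMatY]
  simp only [← liftMatY_mul, ← liftMatY_add, Matrix.mul_assoc]

variable (q) in
/-- **THE FLAT MATRIX OF THE (C) DIRICHLET BOND OPERATOR `Δ_{loc,□}(1) − D P_□(1) D*`**: `deltaLocCubeMatY − ∂·pDirMatY·∂*`.
[cite: Balaban1985BackgroundPropagators, p.395, (3.25)–(3.26) pp.394–395, p.409 l.3–5] -/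
def mlocDirCMatY (S : Finset (SiteY i)) (K : Matrix (SiteY i) (SiteY i) ℝ) (KX : Matrix (BlkCubeY i q) (BlkCubeY i q) ℝ) : Matrix (FBondY i) (FBondY i) ℝ :=
  deltaLocCubeMatY i q - gradK i * pDirMatY i q S K KX * divK i

/-- ★★ **THE `hT1`-SHAPE READING FOR THE CUBE PAIR (C)**: `Δ_{loc,□}(1) − DPDsDirCubeY i □ S 1 = liftOpY 𝔸 (mlocDirCMatY i □ S K K_X)`, under the two displayed inverse
sockets `hK` (sites of `S`) and `hKX` (blocks inside `S`), at any bond transporter trivial at `U = 1`.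
[cite: Balaban1985BackgroundPropagators, p.395, (3.25)–(3.26) pp.394–395, p.409 l.3–5, Cor. 3.5 p.407; Balaban1984PropagatorsII, (2.19) p.227] -/
theorem deltaLocCubeY_sub_DPDsDirCubeY_one {parB : BondParY 𝔸 i} (hparB : ∀ s s', parB (fun _ _ => 1) s s' = 1) (S : Finset (SiteY i))
    {K : Matrix (SiteY i) (SiteY i) ℝ}
    (hK : (mlOpT (toKT i).NB ℓ (toKT i).k (cubeFamY i q).lev (wCube ℓ)).submatrix (fun v : ↥S => (v : SiteY i)) (fun v : ↥S => (v : SiteY i)) *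
      K.submatrix (fun v : ↥S => (v : SiteY i)) (fun v : ↥S => (v : SiteY i)) = 1)
    {KX : Matrix (BlkCubeY i q) (BlkCubeY i q) ℝ}
    (hKX : (xDirMatY i q S K).submatrix (fun v : ↥(insideBlkY i q S) => (v : BlkCubeY i q)) (fun v : ↥(insideBlkY i q S) => (v : BlkCubeY i q)) *
      KX.submatrix (fun v : ↥(insideBlkY i q S) => (v : BlkCubeY i q)) (fun v : ↥(insideBlkY i q S) => (v : BlkCubeY i q)) = 1) :
    B9Eq3105AtLetters.deltaLocCubeY i q parB (fun _ _ => 1) - DPDsDirCubeY i q S (fun _ _ => 1) = liftOpY 𝔸 (mlocDirCMatY i q S K KX) := by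
  rw [deltaLocCubeY_one_liftMatY i hparB, DPDsDirCubeY_one_liftMatY i S hK hKX, mlocDirCMatY, liftOpY_eq_liftMatY, liftMatY_sub]

end CubePair

end Literature.MathematicalPhysics.QuantumFieldTheory.Balaban1983to89.B9Eq3105DirichletBondLettersAtOneY

end
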